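import Mathlib
import Summits.CriticalPhenomena.Ising3DConformalLimit.Theorems.ModularQuarterTurnQuarterTurnAnchorsDefs
import Literature.Probability.Percolation.BondPercolationSymmetry
import HarnessLib

/-!
# `QuarterTurnAnchors`, I: quarter-turn geometry of `ℤ³` and the splitting of the energy over the
# four quadrants (route `ModularQuarterTurn`, item stmt-CriticalPhenomena-6495)

The quarter turn `R` and the diagonal mirror `D` are automorphisms of the nearest-neighbour graph
preserving every centred box; iterates of `R`; how consecutive / opposite quadrants meet (walls,
hinge); every bond is carried into the closed first quadrant by some `Rᵏ`; reindexing of bond sums by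
these symmetries; and the splitting `∑_{e} σ_e = ∑_{k<4} hQ (ω ∘ Rᵏ)` of the (zero-field, `+`
boundary) energy into the four corner energies (Baxter 1976; Friedli–Velenik 2017 §3.1).
-/

namespace Summit.CriticalPhenomena.Ising3DConformalLimit.QuarterTurnCTM

open Literature.Probability.LatticeModels Finset
open scoped Matrix

section

variable (L : ℕ) (β : ℝ)

/-- `R⁴ = id`. [folklore] -/
@[simp] theorem rotR_iterate_four (y : Site 3) : rotR^[4] y = y := by
  show rotR (rotR (rotR (rotR y))) = y
  rw [site_ext_iff]; simp

/-- `R^{n+4} = Rⁿ`. [folklore] -/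
theorem rotR_iterate_add_four (n : ℕ) (y : Site 3) : rotR^[n + 4] y = rotR^[n] y := by
  rw [Function.iterate_add_apply, rotR_iterate_four]

/-- `R^{n mod 4} = Rⁿ`. [folklore] -/
theorem rotR_iterate_mod_four (n : ℕ) (y : Site 3) : rotR^[n % 4] y = rotR^[n] y := by
  conv_rhs => rw [← Nat.mod_add_div n 4]
  induction n / 4 with
  | zero => simp
  | succ m ih =>
    rw [show n % 4 + 4 * (m + 1) = (n % 4 + 4 * m) + 4 by ring, rotR_iterate_add_four, ih]

/-- `R³ = R⁻¹`. [folklore] -/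
theorem rotR_iterate_three (y : Site 3) : rotR^[3] y = rotRinv y := by
  show rotR (rotR (rotR y)) = rotRinv y
  rw [site_ext_iff]; simp

/-- Powers of the permutation `rotEquiv` act as iterates of `rotR`. [folklore] -/
theorem coe_rotEquiv_pow (k : ℕ) : ⇑(rotEquiv ^ k) = rotR^[k] := by
  rw [Equiv.Perm.coe_pow]; rfl

/-- On the diagonal mirror: `R ∘ D = D ∘ R⁻¹`, iterated: `Rᵏ (D y) = D (R⁻¹ᵏ y)`. [folklore] -/
theorem rotR_iterate_mirD (k : ℕ) (y : Site 3) : rotR^[k] (mirD y) = mirD (rotRinv^[k] y) := by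
  induction k generalizing y with
  | zero => rfl
  | succ k ih =>
    rw [Function.iterate_succ_apply', ih, Function.iterate_succ_apply']
    rw [site_ext_iff]; simp

/-- Nearest-neighbour adjacency in `ℤ³` in coordinates. [folklore] -/
theorem adj_iff_coords (x y : Site 3) : (zdGraph 3).Adj x y ↔
    ((y 0 = x 0 + 1 ∧ y 1 = x 1 ∧ y 2 = x 2) ∨ (y 0 = x 0 ∧ y 1 = x 1 + 1 ∧ y 2 = x 2) ∨
      (y 0 = x 0 ∧ y 1 = x 1 ∧ y 2 = x 2 + 1)) ∨
    ((x 0 = y 0 + 1 ∧ x 1 = y 1 ∧ x 2 = y 2) ∨ (x 0 = y 0 ∧ x 1 = y 1 + 1 ∧ x 2 = y 2) ∨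
      (x 0 = y 0 ∧ x 1 = y 1 ∧ x 2 = y 2 + 1)) := by
  rw [zdGraph_adj_iff]
  have key : ∀ u v : Site 3, (∃ i : Fin 3, v = u + Pi.single i 1) ↔
      ((v 0 = u 0 + 1 ∧ v 1 = u 1 ∧ v 2 = u 2) ∨ (v 0 = u 0 ∧ v 1 = u 1 + 1 ∧ v 2 = u 2) ∨
        (v 0 = u 0 ∧ v 1 = u 1 ∧ v 2 = u 2 + 1)) := by
    intro u v
    simp only [Fin.exists_fin_succ, site_ext_iff, Pi.add_apply, Pi.single_apply]
    simp
  rw [← key x y, ← key y x, ← exists_or]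

/-- The quarter turn preserves adjacency. [folklore] -/
theorem adj_rotR_iff (x y : Site 3) : (zdGraph 3).Adj (rotR x) (rotR y) ↔ (zdGraph 3).Adj x y := by
  rw [adj_iff_coords, adj_iff_coords]
  simp only [rotR_apply_zero, rotR_apply_one, rotR_apply_two]
  constructor <;> rintro ((h | h | h) | (h | h | h)) <;> omega

/-- The diagonal mirror preserves adjacency. [folklore] -/
theorem adj_mirD_iff (x y : Site 3) : (zdGraph 3).Adj (mirD x) (mirD y) ↔ (zdGraph 3).Adj x y := by
  rw [adj_iff_coords, adj_iff_coords]
  simp only [mirD_apply_zero, mirD_apply_one, mirD_apply_two]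
  constructor <;> rintro ((h | h | h) | (h | h | h)) <;> omega

/-- Iterates of the quarter turn preserve adjacency. [folklore] -/
theorem adj_rotR_iterate_iff (k : ℕ) (x y : Site 3) :
    (zdGraph 3).Adj (rotR^[k] x) (rotR^[k] y) ↔ (zdGraph 3).Adj x y := by
  induction k generalizing x y with
  | zero => rfl
  | succ k ih => rw [Function.iterate_succ_apply', Function.iterate_succ_apply', adj_rotR_iff, ih]

/-- Iterates of the quarter turn preserve the box. [folklore] -/
@[simp] theorem rotR_iterate_mem_box_iff {L : ℕ} (k : ℕ) (x : Site 3) :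
    rotR^[k] x ∈ box 3 L ↔ x ∈ box 3 L := by
  induction k generalizing x with
  | zero => rfl
  | succ k ih => rw [Function.iterate_succ_apply', rotR_mem_box_iff, ih]

/-- On the wall `P` the quarter turn agrees with the diagonal mirror. [folklore] -/
theorem rotR_eq_mirD_of_mem_wallP {L : ℕ} {x : Site 3} (hx : x ∈ wallP L) : rotR x = mirD x := by
  rw [mem_wallP] at hx
  rw [site_ext_iff]; simp [hx.2.1]

/-- Two consecutive quadrants meet in a wall: `x, R x ∈ Q ⇒ x ∈ P`. [folklore] -/
theorem mem_wallP_of_rotR_mem_quadQ {L : ℕ} {x : Site 3} (hx : x ∈ quadQ L) (hRx : rotR x ∈ quadQ L) :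
    x ∈ wallP L := by
  rw [mem_quadQ] at hx hRx
  rw [mem_wallP]
  simp only [rotR_apply_zero, rotR_apply_one] at hRx
  obtain ⟨hxb, hx0, hx1⟩ := hx
  obtain ⟨-, hR0, hR1⟩ := hRx
  exact ⟨hxb, by omega, hx0⟩

/-- Opposite quadrants meet in the hinge, which the quarter turn fixes: `x, R² x ∈ Q ⇒ R x = x`.
[folklore] -/
theorem rotR_eq_self_of_rotR_rotR_mem_quadQ {L : ℕ} {x : Site 3} (hx : x ∈ quadQ L)
    (h2 : rotR (rotR x) ∈ quadQ L) : rotR x = x := by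
  rw [mem_quadQ] at hx h2
  simp only [rotR_apply_zero, rotR_apply_one, neg_nonneg] at h2
  obtain ⟨-, hx0, hx1⟩ := hx
  obtain ⟨-, h20, h21⟩ := h2
  rw [site_ext_iff]; simp only [rotR_apply_zero, rotR_apply_one, rotR_apply_two, and_true]; omega

/-- `x, R³ x ∈ Q ⇒ R³ x ∈ P` (and `R (R³ x) = x`). [folklore] -/
theorem rotR_three_mem_wallP {L : ℕ} {x : Site 3} (hx : x ∈ quadQ L) (h3 : rotR^[3] x ∈ quadQ L) :
    rotR^[3] x ∈ wallP L := by
  rw [rotR_iterate_three] at h3 ⊢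
  rw [mem_quadQ] at hx h3
  rw [mem_wallP]
  simp only [rotRinv_apply_zero, rotRinv_apply_one] at h3 ⊢
  obtain ⟨-, hx0, hx1⟩ := hx
  obtain ⟨h3b, h30, h31⟩ := h3
  exact ⟨h3b, by omega, h30⟩

/-- `R (R³ x) = x`. [folklore] -/
theorem rotR_rotR_three (x : Site 3) : rotR (rotR^[3] x) = x := by
  rw [rotR_iterate_three, rotR_rotRinv]

/-- `R² = R⁻¹ ∘ R⁻¹`. [folklore] -/
theorem rotRinv_rotRinv (y : Site 3) : rotRinv (rotRinv y) = rotR (rotR y) := by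
  rw [site_ext_iff]; simp

/-- `R⁻³ = R`. [folklore] -/
theorem rotRinv_iterate_three (y : Site 3) : rotRinv^[3] y = rotR y := by
  show rotRinv (rotRinv (rotRinv y)) = rotR y
  rw [site_ext_iff]; simp

/-- `R²` as an iterate. [folklore] -/
theorem rotR_iterate_two (y : Site 3) : rotR^[2] y = rotR (rotR y) := rfl

/-- Every nearest-neighbour bond of `ℤ³` is carried by some power of the quarter turn into the closed
first quadrant `{0 ≤ x₀, 0 ≤ x₁}` (both endpoints at once). [folklore] -/
theorem exists_rotR_iterate_nonneg {x y : Site 3} (h : (zdGraph 3).Adj x y) :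
    ∃ k : Fin 4, (0 ≤ (rotR^[k] x) 0 ∧ 0 ≤ (rotR^[k] x) 1) ∧ (0 ≤ (rotR^[k] y) 0 ∧ 0 ≤ (rotR^[k] y) 1) := by
  rw [adj_iff_coords] at h
  rcases le_or_gt 0 (x 0 + y 0) with h0 | h0 <;> rcases le_or_gt 0 (x 1 + y 1) with h1 | h1
  · refine ⟨0, ?_⟩
    simp only [Fin.isValue, Fin.val_zero, Function.iterate_zero, id_eq]
    omega
  · refine ⟨1, ?_⟩
    simp only [Fin.isValue, Fin.val_one, Function.iterate_one, rotR_apply_zero, rotR_apply_one]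
    omega
  · refine ⟨3, ?_⟩
    simp only [show ((3 : Fin 4) : ℕ) = 3 from rfl, rotR_iterate_three, rotRinv_apply_zero,
      rotRinv_apply_one]
    omega
  · refine ⟨2, ?_⟩
    simp only [show ((2 : Fin 4) : ℕ) = 2 from rfl, rotR_iterate_two, rotR_apply_zero, rotR_apply_one]
    omega

/-- For a nearest-neighbour bond the diagonal site plane `x₀ = x₁` is never crossed strictly: both
endpoints lie (weakly) below it or both (weakly) above it. [folklore] -/
theorem adj_low_or_up {x y : Site 3} (h : (zdGraph 3).Adj x y) :
    (x 1 ≤ x 0 ∧ y 1 ≤ y 0) ∨ (x 0 ≤ x 1 ∧ y 0 ≤ y 1) := by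
  rw [adj_iff_coords] at h
  omega

/-- A bijection of `ℤ³` preserving adjacency and the box permutes the bonds touching the box, so bond
sums may be reindexed by it. [folklore] -/
theorem sum_edgesTouching_comp_equiv (ψ : Site 3 ≃ Site 3)
    (hadj : ∀ x y, (zdGraph 3).Adj (ψ x) (ψ y) ↔ (zdGraph 3).Adj x y)
    (hΛ : ∀ x, x ∈ box 3 L ↔ ψ x ∈ box 3 L) (f : Sym2 (Site 3) → ℝ) :
    ∑ e ∈ edgesTouching (zdGraph 3) (box 3 L), f (Sym2.map ψ e) =
      ∑ e ∈ edgesTouching (zdGraph 3) (box 3 L), f e := by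
  refine Finset.sum_equiv (Literature.Probability.Percolation.sym2Equiv ψ) (fun e => ?_) (fun e _ => rfl)
  have := mem_interactionEdges_map_iff (zdGraph 3) ψ hadj hΛ (.fixed 1) e
  rwa [interactionEdges_fixed] at this

/-- Reindexing a bond sum by a power of the quarter turn. [folklore] -/
theorem sum_edgesTouching_comp_rotR_iterate (j : ℕ) (f : Sym2 (Site 3) → ℝ) :
    ∑ e ∈ edgesTouching (zdGraph 3) (box 3 L), f (Sym2.map (rotR^[j]) e) =
      ∑ e ∈ edgesTouching (zdGraph 3) (box 3 L), f e := by
  rw [← coe_rotEquiv_pow]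
  refine sum_edgesTouching_comp_equiv L (rotEquiv ^ j) (fun x y => ?_) (fun x => ?_) f
  · rw [coe_rotEquiv_pow]; exact adj_rotR_iterate_iff j x y
  · rw [coe_rotEquiv_pow]; exact (rotR_iterate_mem_box_iff j x).symm

/-- Reindexing a bond sum by the diagonal mirror. [folklore] -/
theorem sum_edgesTouching_comp_mirD (f : Sym2 (Site 3) → ℝ) :
    ∑ e ∈ edgesTouching (zdGraph 3) (box 3 L), f (Sym2.map mirD e) =
      ∑ e ∈ edgesTouching (zdGraph 3) (box 3 L), f e := by
  rw [← coe_mirEquiv]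
  exact sum_edgesTouching_comp_equiv L mirEquiv (fun x y => adj_mirD_iff x y)
    (fun x => (mirD_mem_box_iff x).symm) f

/-- `σ_e(ω ∘ f) = σ_{f e}(ω)` for any map `f` of the sites. [folklore] -/
theorem bondSpin_comp_fun (ω : SpinConfig (Site 3)) (f : Site 3 → Site 3) (e : Sym2 (Site 3)) :
    bondSpin (ω ∘ f) e = bondSpin ω (Sym2.map f e) := by
  induction e using Sym2.ind with
  | _ x y => simp [bondSpin_mk, spinAt]

/-- The quadrant indicator is nonnegative. [folklore] -/
theorem qind_nonneg (x y : Site 3) : 0 ≤ qind L x y := by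
  unfold qind; split_ifs <;> norm_num

/-- The quadrant indicator is `1` when both endpoints have nonnegative first two coordinates. [folklore] -/
theorem qind_eq_one_of {x y : Site 3} (hx : 0 ≤ x 0 ∧ 0 ≤ x 1) (hy : 0 ≤ y 0 ∧ 0 ≤ y 1) :
    qind L x y = 1 := by
  unfold qind; rw [if_pos ⟨fun _ => hx, fun _ => hy⟩]

/-- If the indicator does not vanish, box endpoints lie in the quadrant. [folklore] -/
theorem of_qind_ne_zero {x y : Site 3} (h : qind L x y ≠ 0) :
    (x ∈ box 3 L → 0 ≤ x 0 ∧ 0 ≤ x 1) ∧ (y ∈ box 3 L → 0 ≤ y 0 ∧ 0 ≤ y 1) := by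
  unfold qind at h; by_contra hc; exact h (if_neg hc)

/-- `nrot` is invariant under the quarter turn (it counts over a full cycle of `R`). [folklore] -/
theorem nrot_rotR (x y : Site 3) : nrot L (rotR x) (rotR y) = nrot L x y := by
  unfold nrot
  simp only [← Function.iterate_succ_apply, Fin.sum_univ_four, Fin.isValue, Fin.val_zero,
    Fin.val_one, Fin.val_two, show ((3 : Fin 4) : ℕ) = 3 from rfl,
    rotR_iterate_four, Function.iterate_zero, id_eq]
  ring

/-- `nrot` is invariant under every power of the quarter turn. [folklore] -/
theorem nrot_rotR_iterate (k : ℕ) (x y : Site 3) : nrot L (rotR^[k] x) (rotR^[k] y) = nrot L x y := by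
  induction k generalizing x y with
  | zero => rfl
  | succ k ih => rw [Function.iterate_succ_apply', Function.iterate_succ_apply', nrot_rotR, ih]

/-- For a bond of the lattice, `nrot ≠ 0`: some quarter turn carries it into the first quadrant.
[folklore] -/
theorem nrot_pos {x y : Site 3} (h : (zdGraph 3).Adj x y) : 0 < nrot L x y := by
  obtain ⟨k, hkx, hky⟩ := exists_rotR_iterate_nonneg h
  unfold nrot
  have h1 : qind L (rotR^[k] x) (rotR^[k] y) ≤ ∑ k : Fin 4, qind L (rotR^[k] x) (rotR^[k] y) :=
    Finset.single_le_sum (f := fun k : Fin 4 => qind L (rotR^[k] x) (rotR^[k] y))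
      (fun i _ => qind_nonneg L _ _) (Finset.mem_univ k)
  rw [qind_eq_one_of L hkx hky] at h1
  linarith

/-- **The quadrant weights of the four rotated copies of a bond add up to one**:
`∑_{k<4} qwt (Rᵏ x) (Rᵏ y) = 1` for every bond `{x, y}` of `ℤ³`. [folklore] -/
theorem sum_qwt_rotR_iterate {x y : Site 3} (h : (zdGraph 3).Adj x y) :
    ∑ k : Fin 4, qwt L (rotR^[k] x) (rotR^[k] y) = 1 := by
  unfold qwt
  simp_rw [nrot_rotR_iterate]
  rw [← Finset.sum_mul]
  exact mul_inv_cancel₀ (nrot_pos L h).ne' 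

/-- **Splitting of the energy over the four quadrants**: for every configuration `ω`,
`∑_{e touching the box} σ_e(ω) = ∑_{k<4} hQ (ω ∘ Rᵏ)` — each bond is shared among the quadrants
containing it with total weight one. [folklore] -/
theorem sum_bondSpin_eq_sum_hQ (ω : SpinConfig (Site 3)) :
    ∑ e ∈ edgesTouching (zdGraph 3) (box 3 L), bondSpin ω e = ∑ k : Fin 4, hQ L (ω ∘ rotR^[k]) := by
  unfold hQ
  -- bring each rotated sum back to the unrotated bond
  have step : ∀ k : Fin 4, ∑ e ∈ edgesTouching (zdGraph 3) (box 3 L), quadCoeff L e * bondSpin (ω ∘ rotR^[k]) e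
      = ∑ e ∈ edgesTouching (zdGraph 3) (box 3 L), quadCoeff L (Sym2.map (rotR^[4 - k]) e) * bondSpin ω e := by
    intro k
    rw [← sum_edgesTouching_comp_rotR_iterate L (4 - k)
      (fun e => quadCoeff L e * bondSpin (ω ∘ rotR^[k]) e)]
    refine Finset.sum_congr rfl fun e _ => ?_
    rw [bondSpin_comp_fun, Sym2.map_map, ← Function.iterate_add,
      show (k : ℕ) + (4 - k) = 4 by have := k.2; omega]
    congr 1
    rw [show (rotR^[4] : Site 3 → Site 3) = id from funext rotR_iterate_four, Sym2.map_id, id_eq]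
  simp_rw [step]
  rw [Finset.sum_comm]
  refine Finset.sum_congr rfl fun e he => ?_
  rw [← Finset.sum_mul]
  -- the rotated weights of the bond `e` add up to one
  suffices hsum : ∑ k : Fin 4, quadCoeff L (Sym2.map (rotR^[4 - k]) e) = 1 by rw [hsum, one_mul]
  have hadj : e ∈ (zdGraph 3).edgeSet := (mem_edgesTouching_iff.1 he).1
  induction e using Sym2.ind with
  | _ x y =>
    rw [SimpleGraph.mem_edgeSet] at hadj
    have h4 : ∀ f : ℕ → ℝ, f 4 = f 0 → ∑ k : Fin 4, f (4 - k) = ∑ k : Fin 4, f k := by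
      intro f hf
      simp only [Fin.sum_univ_four, Fin.isValue, Fin.val_zero, Fin.val_one, Fin.val_two,
        show ((3 : Fin 4) : ℕ) = 3 from rfl, hf]
      ring
    simp only [Sym2.map_mk, quadCoeff_mk]
    rw [h4 (fun n => qwt L (rotR^[n] x) (rotR^[n] y)) (by simp only [rotR_iterate_four,
      Function.iterate_zero, id_eq])]
    exact sum_qwt_rotR_iterate L hadj

end

end Summit.CriticalPhenomena.Ising3DConformalLimit.QuarterTurnCTM
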